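import Literature.Computability.AlgebraicComplexity.TruncatedPolynomialBorderRankAllFields
import Literature.Computability.AlgebraicComplexity.DegenerationSpectralMonotone
import Literature.Computability.AlgebraicComplexity.BorderRankRestriction
import Literature.Computability.AlgebraicComplexity.TensorRestrictionRank
import Mathlib.LinearAlgebra.Vandermonde
import Mathlib.LinearAlgebra.Matrix.NonsingularInverse
import Mathlib.RingTheory.RootsOfUnity.Complex
import HarnessLib

/-!
# Moment-curve frames degenerate to their tight shadow `K[T]/(T^m)|_{deg < a}`
# (route `SaturationLadder`, item stmt-MatrixMultiplication-25909 `SubexpSaturation`; cell `decomp-mm`, lens 1, gen 33)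

PROVED, 0 sorry; two coordinate-tensor definitions (`frameTensor`, `shadowTensor`), no instances, no
notation, no named facts, route-free (imports `Literature` + Mathlib only).

*The question priced.*  Gen 32 of this lens isolated the FLAT FRAMES `P_{a,m} = Σ_{i<m} e_i ⊗ φ_i ⊗ e_i`
(`(φ_i)_{i<m}` a frame of `K^a` in general position; minimal border rank `m`, non-tight) as the canonical
specimens passing every instrument of the lineage, and wrote (memo g32 §3.6) that "no group or additive
structure is present" in them.  For the MOMENT-CURVE frames `φ_i = (λ_i^k)_{k<a}` — up to
`GL_a × GL_m × GL_m` these are all frames with `a = 2` (the trine `P_{2,3}`, the roots-of-unity frames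
`P_{2,m}(ω)`), all simplex frames `S_a = P_{a,a+1}` and all frames with `m ≤ a + 2` (Castelnuovo: `a + 2`
points of `P^{a−1}` in general position lie on a rational normal curve) — this file proves the contrary:
* `frameTensor K a m λ` (entry `[y = z]·λ_z^k` at `(z,k,y)`, output slot first as in the tree) is the
  structure tensor of the semisimple algebra `K[T]/(∏_i (T − λ_i)) ≅ K^m` in the idempotent basis on the
  two `m`-legs and the power basis `T^k, k < a` on the multiplier leg — a LEG-RESTRICTED UNIT TENSOR,
  `⟨a⟩ ≤ P_{a,m}(λ) ≤ ⟨m⟩` (`unitTensor_restrictsTo_frameTensor`; `frameTensor_restrictsTo_unitTensor` for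
  distinct nodes, by inverting a Vandermonde matrix), `algBorderRank_frameTensor : R̲ = m` (`0 < a`);
* `shadowTensor K a m` (entry `[k + y = z]`) is the same leg restriction of the tree's `truncPolyMulTensor K m`,
  the TIGHT structure tensor of `K[T]/(T^m)` (additive labelling `z = k + y`):
  `truncPolyMulTensor_restrictsTo_shadowTensor`, `shadowTensor_self`, `algBorderRank_shadowTensor : R̲ = m`
  (`0 < a ≤ m`, every field, via the tree's root-of-unity-free `BCS1997_ex_15_9_le`);
* **`frameTensor_degeneratesTo_shadowTensor`: for pairwise distinct nodes (any field, `a ≤ m`) the frame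
  DEGENERATES to the shadow, `P_{a,m}(λ) ⊵ N_{a,m}`** — the nodes `λ_i ε → 0` collapse
  `K(ε)[T]/(∏ (T − λ_i ε))` onto `K[T]/(T^m)` (BCS Ex. 15.9; the tree's cleared Lagrange interpolation
  `BCS1997Ex159.*`) compatibly with the degree filtration of the multiplier leg; the roots-of-unity case is
  BCS Example (15.20) with its printed matrices (`isApproxRestriction_frameTensor_rootsOfUnity`, order
  `m − 1`); both through `isApproxRestriction_frame_of_isApproxDecomposition` (an approximate decomposition
  of `K[T]/(T^m)` with diagonal-monomial second leg `v_ρ(x) = λ_ρ^x ε^x` IS a degeneration from the frame);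
* hence `P^{⊠N} ⊵ N^{⊠N}` (`frameTensor_kroneckerPow_degeneratesTo`) and, for every universal spectral point
  `F` (tree `IsUniversalSpectralPoint`), **`max(F⟨a⟩, F(N_{a,m})) ≤ F(P_{a,m}(λ)) ≤ m`** (`spectral_sandwich`,
  `map_unitTensor_le_frameTensor`, `spectral_sandwich_complex` at `λ_i = e^{2πi·i/m}`).

*Reading for the node (g33).*  The open object of g32 splits: whatever Strassen's support functionals /
the laser method extract from powers of the tight shadow is extracted from the frame powers too
(`P^{⊠N} ⊵ N^{⊠N}`), so the "shadow part" of a frame's value is in print and in class (a tight commutative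
minimal-border-rank base, priced by the lineage's additive analysis); the open part is the LIFT, the
strict gap between a frame and its shadow in the asymptotic spectrum (memo §3, by hand).  The additive
structure g32 missed is the associated graded of the semisimple algebra, one degeneration away.  Nothing
here is evidence about the truth of `SubexpSaturation`.

*Print scope.*  Bürgisser–Clausen–Shokrollahi (1997) Example (15.20), Ex. 15.9, (14.19), (15.25);
Bläser (2013) Lemma 7.1, Def. 7.2; Landsberg (2017) §5.6 (structure tensors of `ℂ[x]/(q)`, Bläser–Lysikov);
Strassen (1988) §3.  The leg-restricted statements (`a < m`) and the frame ↔ algebra dictionary are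
folklore-level corollaries assembled here.  References: [BurgisserClausenShokrollahi1997], [Blaser2013],
[Landsberg2017], [Strassen1988], [ChristandlVranaZuiddam2023].
-/

set_option linter.dupNamespace false

noncomputable section

open scoped BigOperators Polynomial

namespace Summit.MatrixMultiplication.MatrixMultiplication.Theorems.SaturationLadderFrameShadows

open Literature.Computability.AlgebraicComplexity Polynomial

universe u

/-! ## §0 The two coordinate tensors -/

section Defs

variable (K : Type u) [CommSemiring K]

/-- The **moment-curve frame** `P_{a,m}(λ) = Σ_{z<m} e_z ⊗ (λ_z^k)_{k<a} ⊗ e_z` on the format `m × a × m`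
(output slot `z` first, multiplier slot `k < a` second): entry `λ_z^k` at `(z, k, z)`, `0` elsewhere; for
distinct `λ` the structure tensor of `K[T]/(∏_z (T − λ_z))` (idempotent bases on the `m`-legs, power
basis `T^k`, `k < a`, on the multiplier leg). [cite: BurgisserClausenShokrollahi1997, Ex. 15.9] -/
def frameTensor (a m : ℕ) (lam : Fin m → K) : Fin m → Fin a → Fin m → K :=
  fun z k y => if y = z then lam z ^ (k : ℕ) else 0

/-- Entries of the frame. [folklore] -/
@[simp] theorem frameTensor_apply (a m : ℕ) (lam : Fin m → K) (z : Fin m) (k : Fin a) (y : Fin m) :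
    frameTensor K a m lam z k y = if y = z then lam z ^ (k : ℕ) else 0 := rfl

/-- The **tight shadow** `N_{a,m} = K[T]/(T^m)|_{deg < a}`: the tree's `truncPolyMulTensor` with the
multiplier leg restricted to `1, T, …, T^{a−1}`; entry `[k + y = z]` at `(z, k, y)`. [cite: BurgisserClausenShokrollahi1997, Example (15.20)] -/
def shadowTensor (a m : ℕ) : Fin m → Fin a → Fin m → K :=
  fun z k y => if (k : ℕ) + y = z then 1 else 0

/-- Entries of the shadow. [folklore] -/
@[simp] theorem shadowTensor_apply (a m : ℕ) (z : Fin m) (k : Fin a) (y : Fin m) :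
    shadowTensor K a m z k y = if (k : ℕ) + y = z then 1 else 0 := rfl

/-- `N_{m,m}` IS the tree's structure tensor of `K[T]/(T^m)`. [cite: BurgisserClausenShokrollahi1997, Example (15.20)] -/
theorem shadowTensor_self (m : ℕ) : shadowTensor K m m = truncPolyMulTensor K m := rfl

end Defs

/-! ## §1 The frame is a leg-restricted unit tensor: `R ≤ m`, `⟨m⟩ ≥ P_{a,m}(λ)`, `R̲ = m` -/

section FieldK

variable (K : Type u) [Field K] {a m : ℕ}

/-- `P_{a,m}(λ) = Σ_z e_z ⊗ (λ_z^k)_k ⊗ e_z`: `m` triads. [folklore] -/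
theorem frameTensor_eq_sum_triad (lam : Fin m → K) :
    frameTensor K a m lam = ∑ z : Fin m, triad (fun z' => if z' = z then (1 : K) else 0)
      (fun k : Fin a => lam z ^ (k : ℕ)) (fun y => if y = z then (1 : K) else 0) := by
  funext z' k y
  rw [Finset.sum_apply, Finset.sum_apply, Finset.sum_apply,
    Finset.sum_eq_single z' (fun z _ hz => by simp [triad_apply, Ne.symm hz])
      (fun h => absurd (Finset.mem_univ z') h)]
  rw [frameTensor_apply, triad_apply, if_pos rfl, one_mul]
  by_cases h : y = z'
  · rw [if_pos h, if_pos h, mul_one]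
  · rw [if_neg h, if_neg h, mul_zero]

/-- `R(P_{a,m}(λ)) ≤ m`. [folklore] -/
theorem tensorRank_frameTensor_le (lam : Fin m → K) : tensorRank (frameTensor K a m lam) ≤ m := by
  have h := tensorRank_le_card_of_eq_sum _ _ _ (frameTensor_eq_sum_triad K (a := a) lam)
  rwa [Fintype.card_fin] at h

/-- `R̲(P_{a,m}(λ)) ≤ m`. [folklore] -/
theorem algBorderRank_frameTensor_le (lam : Fin m → K) : algBorderRank (frameTensor K a m lam) ≤ m :=
  (algBorderRank_le_tensorRank _).trans (tensorRank_frameTensor_le K lam)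

/-- **The frame is a restriction of the unit tensor `⟨m⟩`** (`P = (Φ ⊗ 1 ⊗ 1)·⟨m⟩`, g32 §3.1).
[cite: BurgisserClausenShokrollahi1997, (14.19)] -/
theorem unitTensor_restrictsTo_frameTensor (lam : Fin m → K) :
    TensorRestrictsTo (unitTensor K m) (frameTensor K a m lam) :=
  tensorRestrictsTo_unitTensor_of_tensorRank_le _ (tensorRank_frameTensor_le K lam)

/-- The `z`-slices of the frame are linearly independent (`0 < a`: slice `z` alone has the entry
`λ_z^0 = 1` at `(0, z)`). [cite: Blaser2013, Lemma 7.1(2) (proof)] -/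
theorem linearIndependent_frameTensor (ha : 0 < a) (lam : Fin m → K) :
    LinearIndependent K (fun z => frameTensor K a m lam z : Fin m → Fin a → Fin m → K) := by
  rw [Fintype.linearIndependent_iff]
  intro g hg z
  have h := congr_fun (congr_fun hg ⟨0, ha⟩) z
  rw [Finset.sum_apply, Finset.sum_apply, Pi.zero_apply, Pi.zero_apply,
    Finset.sum_eq_single z] at h
  · simpa using h
  · intro z' _ hz'
    simp only [Pi.smul_apply, frameTensor_apply, smul_eq_mul]
    rw [if_neg (fun hh => hz' hh.symm), mul_zero]
  · exact fun hh => absurd (Finset.mem_univ z) hh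

/-- `m ≤ R̲(P_{a,m}(λ))` (`0 < a`), over every field. [cite: Blaser2013, Lemma 7.1(2) (proof)] -/
theorem m_le_algBorderRank_frameTensor (ha : 0 < a) (lam : Fin m → K) :
    m ≤ algBorderRank (frameTensor K a m lam) := by
  have h := card_le_algBorderRank_of_linearIndependent _ (linearIndependent_frameTensor K ha lam)
  rwa [Fintype.card_fin] at h

/-- **`R̲(P_{a,m}(λ)) = m`**: the frame is flat, for every node vector and every field (`0 < a`). [folklore] -/
theorem algBorderRank_frameTensor (ha : 0 < a) (lam : Fin m → K) :
    algBorderRank (frameTensor K a m lam) = m :=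
  le_antisymm (algBorderRank_frameTensor_le K lam) (m_le_algBorderRank_frameTensor K ha lam)

/-- **`P_{a,m}(λ) ≥ ⟨a⟩` for pairwise distinct nodes** (`a ≤ m`): keep the first `a` points and
invert the `a × a` Vandermonde matrix on the multiplier leg (so `Q(P_{a,m}(λ)) ≥ a` and every universal
spectral point satisfies `a ≤ F(P_{a,m}(λ))`). [cite: BurgisserClausenShokrollahi1997, (14.19)] -/
theorem frameTensor_restrictsTo_unitTensor {lam : Fin m → K} (hlam : Function.Injective lam)
    (ham : a ≤ m) : TensorRestrictsTo (frameTensor K a m lam) (unitTensor K a) := by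
  classical
  obtain ⟨v, hv⟩ : ∃ v : Fin a → K, v = fun i => lam (Fin.castLE ham i) := ⟨_, rfl⟩
  have hvinj : Function.Injective v := by
    intro i j h
    have h' : lam (Fin.castLE ham i) = lam (Fin.castLE ham j) := by simpa [hv] using h
    exact Fin.castLE_injective ham (hlam h')
  obtain ⟨V, hV⟩ : ∃ V : Matrix (Fin a) (Fin a) K, V = (Matrix.vandermonde v).transpose := ⟨_, rfl⟩
  have hdet : IsUnit V.det := by
    rw [hV, Matrix.det_transpose, isUnit_iff_ne_zero]
    exact Matrix.det_vandermonde_ne_zero_iff.2 hvinj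
  have hinv : ∀ k'' z'' : Fin a, ∑ k, V⁻¹ k'' k * v z'' ^ (k : ℕ) = if k'' = z'' then 1 else 0 := by
    intro k'' z''
    have h := congr_fun (congr_fun (Matrix.nonsing_inv_mul V hdet) k'') z''
    rw [Matrix.mul_apply, Matrix.one_apply] at h
    rw [← h]
    refine Finset.sum_congr rfl fun k _ => ?_
    rw [hV, Matrix.transpose_apply, Matrix.vandermonde_apply]
  refine ⟨fun z'' z => if z = Fin.castLE ham z'' then 1 else 0, fun k'' k => V⁻¹ k'' k,
    fun y'' y => if y = Fin.castLE ham y'' then 1 else 0, fun z'' k'' y'' => ?_⟩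
  rw [Finset.sum_eq_single (Fin.castLE ham z'') (fun z _ hz => by simp [hz])
    (fun h => absurd (Finset.mem_univ _) h)]
  have hy : ∀ k : Fin a, (∑ y : Fin m, (if Fin.castLE ham z'' = Fin.castLE ham z'' then (1 : K) else 0) *
      V⁻¹ k'' k * (if y = Fin.castLE ham y'' then 1 else 0) *
        frameTensor K a m lam (Fin.castLE ham z'') k y) =
      V⁻¹ k'' k * frameTensor K a m lam (Fin.castLE ham z'') k (Fin.castLE ham y'') := by
    intro k
    rw [Finset.sum_eq_single (Fin.castLE ham y'') (fun y _ hy => by simp [hy])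
      (fun h => absurd (Finset.mem_univ _) h), if_pos rfl, if_pos rfl, one_mul, mul_one]
  rw [Finset.sum_congr rfl fun k _ => hy k, unitTensor_apply]
  by_cases hzy : y'' = z''
  · subst hzy
    have e : ∀ k : Fin a, V⁻¹ k'' k * frameTensor K a m lam (Fin.castLE ham y'') k (Fin.castLE ham y'') =
        V⁻¹ k'' k * v y'' ^ (k : ℕ) := by
      intro k
      rw [frameTensor_apply, if_pos rfl, hv]
    rw [Finset.sum_congr rfl fun k _ => e k, hinv]
    by_cases hk : k'' = y''
    · subst hk
      rw [if_pos rfl, if_pos (And.intro rfl rfl)]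
    · rw [if_neg hk, if_neg (show ¬(y'' = k'' ∧ k'' = y'') from fun h => hk h.2)]
  · have hne : Fin.castLE ham y'' ≠ Fin.castLE ham z'' := fun h => hzy (Fin.castLE_injective ham h)
    have e : ∀ k : Fin a, V⁻¹ k'' k * frameTensor K a m lam (Fin.castLE ham z'') k (Fin.castLE ham y'') = 0 := by
      intro k
      rw [frameTensor_apply, if_neg hne, mul_zero]
    rw [Finset.sum_congr rfl fun k _ => e k, Finset.sum_const_zero,
      if_neg (show ¬(z'' = k'' ∧ k'' = y'') from fun h => hzy (h.1.trans h.2).symm)]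

/-! ## §2 The shadow is a leg-restricted `K[T]/(T^m)`: `R̲ = m` -/

/-- **`K[T]/(T^m) ≥ N_{a,m}`** (zero out the multiplier coordinates `T^a, …, T^{m−1}`). [cite: Blaser2013, Def. 7.2] -/
theorem truncPolyMulTensor_restrictsTo_shadowTensor (ham : a ≤ m) :
    TensorRestrictsTo (truncPolyMulTensor K m) (shadowTensor K a m) := by
  have h : shadowTensor K a m = fun z k y => truncPolyMulTensor K m z (Fin.castLE ham k) y := by
    funext z k y; rw [shadowTensor_apply, truncPolyMulTensor_apply, Fin.val_castLE]
  rw [h]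
  exact tensorRestrictsTo_precomp (truncPolyMulTensor K m) (fun z => z) (Fin.castLE ham) (fun y => y)

/-- `R̲(N_{a,m}) ≤ m` (`a ≤ m`), over every field (the tree's root-of-unity-free BCS Ex. 15.9).
[cite: BurgisserClausenShokrollahi1997, Ex. 15.9] -/
theorem algBorderRank_shadowTensor_le (ham : a ≤ m) : algBorderRank (shadowTensor K a m) ≤ m :=
  (truncPolyMulTensor_restrictsTo_shadowTensor K ham).algBorderRank_le.trans (BCS1997_ex_15_9_le K m)

/-- The `z`-slices of the shadow are linearly independent (`0 < a`). [cite: Blaser2013, Lemma 7.1(2) (proof)] -/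
theorem linearIndependent_shadowTensor (ha : 0 < a) :
    LinearIndependent K (fun z => shadowTensor K a m z : Fin m → Fin a → Fin m → K) := by
  rw [Fintype.linearIndependent_iff]
  intro g hg z
  have h := congr_fun (congr_fun hg ⟨0, ha⟩) z
  rw [Finset.sum_apply, Finset.sum_apply, Pi.zero_apply, Pi.zero_apply,
    Finset.sum_eq_single z] at h
  · simpa using h
  · intro z' _ hz'
    simp only [Pi.smul_apply, shadowTensor_apply, smul_eq_mul, zero_add]
    rw [if_neg (fun hh => hz' (Fin.ext hh.symm)), mul_zero]
  · exact fun hh => absurd (Finset.mem_univ z) hh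

/-- `m ≤ R̲(N_{a,m})` (`0 < a`), over every field. [cite: Blaser2013, Lemma 7.1(2) (proof)] -/
theorem m_le_algBorderRank_shadowTensor (ha : 0 < a) : m ≤ algBorderRank (shadowTensor K a m) := by
  have h := card_le_algBorderRank_of_linearIndependent _ (linearIndependent_shadowTensor K (m := m) ha)
  rwa [Fintype.card_fin] at h

/-- **`R̲(N_{a,m}) = m`** (`0 < a ≤ m`): the shadow is flat as well, over every field. [folklore] -/
theorem algBorderRank_shadowTensor (ha : 0 < a) (ham : a ≤ m) : algBorderRank (shadowTensor K a m) = m :=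
  le_antisymm (algBorderRank_shadowTensor_le K ham) (m_le_algBorderRank_shadowTensor K ha)

/-! ## §3 The degeneration `P_{a,m}(λ) ⊵ N_{a,m}` -/

/-- **Transfer lemma.**  An approximate decomposition of `K[T]/(T^m)` of order `h` with `r` triads whose
SECOND leg is diagonal-monomial, `v_ρ(x) = λ_ρ^x ε^x`, is a degeneration of order `h` of the shadow
`N_{a,m}` FROM THE FRAME `P_{a,r}(λ)`: the frame supplies the scalars `λ_ρ^k` (collapsing `y = ρ`), the
diagonal matrix `ε^k` on the multiplier leg supplies the powers of `ε`, the other two legs are the given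
`u`, `w`. [cite: BurgisserClausenShokrollahi1997, (15.19) and Example (15.20)] -/
theorem isApproxRestriction_frame_of_isApproxDecomposition {h r : ℕ} (ham : a ≤ m) (lam : Fin r → K)
    {u : Fin r → Fin m → K[X]} {v : Fin r → Fin m → K[X]} {w : Fin r → Fin m → K[X]}
    (huvw : IsApproxDecomposition h (truncPolyMulTensor K m) u v w)
    (hv : ∀ ρ x, v ρ x = C (lam ρ ^ (x : ℕ)) * X ^ (x : ℕ)) :
    IsApproxRestriction h (frameTensor K a r lam) (shadowTensor K a m) (fun z' ρ => u ρ z')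
      (fun k' k => if k = k' then X ^ (k' : ℕ) else 0) (fun y' ρ => w ρ y') := by
  intro z' k' y' j hj
  have hx : ((Fin.castLE ham k' : Fin m) : ℕ) = k' := Fin.val_castLE ham k'
  have key := huvw z' (Fin.castLE ham k') y' j hj
  have hsum : (∑ ρ : Fin r, ∑ k : Fin a, ∑ y : Fin r, u ρ z' * (if k = k' then X ^ (k' : ℕ) else 0) *
      w y y' * C (frameTensor K a r lam ρ k y)) = ∑ ρ, u ρ z' * v ρ (Fin.castLE ham k') * w ρ y' := by
    refine Finset.sum_congr rfl fun ρ _ => ?_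
    rw [Finset.sum_eq_single k' (fun k _ hk => by simp [hk]) (fun hk => absurd (Finset.mem_univ _) hk),
      Finset.sum_eq_single ρ (fun y _ hy => by simp [hy]) (fun hρ => absurd (Finset.mem_univ _) hρ),
      hv ρ (Fin.castLE ham k'), hx, frameTensor_apply, if_pos rfl, if_pos rfl]
    ring
  dsimp only
  rw [hsum, key, truncPolyMulTensor_apply, hx, shadowTensor_apply]

variable {K} in
/-- **BCS Example (15.20), leg-restricted: the roots-of-unity frame degenerates to the shadow in order
`m − 1`** — `P_{a,m}(1, ζ, …, ζ^{m−1}) ⊵_{m−1} N_{a,m}` with the printed matrices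
`A_{z'ρ} = ζ^{ρ(m−z')}/m · ε^{m−1−z'}`, `B = diag(ε^k)`, `C_{y'ρ} = ζ^{ρ y'} ε^{y'}`
(`ζ` a primitive `m`-th root of unity, `a ≤ m`). [cite: BurgisserClausenShokrollahi1997, Example (15.20)] -/
theorem isApproxRestriction_frameTensor_rootsOfUnity {ζ : K} (hζ : IsPrimitiveRoot ζ m) (hm : 0 < m)
    (ham : a ≤ m) :
    IsApproxRestriction (m - 1) (frameTensor K a m fun ρ => ζ ^ (ρ : ℕ)) (shadowTensor K a m)
      (fun z' ρ => C (ζ ^ ((ρ : ℕ) * (m - z')) * (m : K)⁻¹) * X ^ (m - 1 - z'))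
      (fun k' k => if k = k' then X ^ (k' : ℕ) else 0)
      (fun y' ρ => C (ζ ^ ((ρ : ℕ) * y')) * X ^ (y' : ℕ)) :=
  isApproxRestriction_frame_of_isApproxDecomposition K ham (fun ρ => ζ ^ (ρ : ℕ))
    (BCS1997_ex_15_20_isApproxDecomposition hζ hm) (fun ρ x => by rw [← pow_mul])

variable {K} in
/-- Hence `P_{a,m}(1, ζ, …, ζ^{m−1}) ⊵ N_{a,m}`. [cite: BurgisserClausenShokrollahi1997, Example (15.20)] -/
theorem frameTensor_rootsOfUnity_degeneratesTo_shadowTensor {ζ : K} (hζ : IsPrimitiveRoot ζ m)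
    (hm : 0 < m) (ham : a ≤ m) :
    AlgDegeneratesTo (frameTensor K a m fun ρ => ζ ^ (ρ : ℕ)) (shadowTensor K a m) :=
  ⟨m - 1, _, _, _, isApproxRestriction_frameTensor_rootsOfUnity hζ hm ham⟩

variable {K} in
/-- **BCS Ex. 15.9, leg-restricted: EVERY moment-curve frame with pairwise distinct nodes degenerates to
the shadow**, `P_{a,m}(λ) ⊵ N_{a,m}` (`a ≤ m`, every field): the cleared Lagrange-interpolation triads of
`K(ε)[T]/(∏ (T − λ_ρ ε))` at the nodes `λ_ρ ε` (tree `BCS1997Ex159.sum_triads_eq_mul_coeff_modByMonic`,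
`…coeff_zero_coeff_X_pow_modByMonic_nodal`, `isApproxDecomposition_of_sum_eq_mul_of_coeff_zero`) have
the diagonal-monomial second leg `(λ_ρ ε)^x`, so the transfer lemma applies. [cite: BurgisserClausenShokrollahi1997, Ex. 15.9] -/
theorem frameTensor_degeneratesTo_shadowTensor {lam : Fin m → K} (hlam : Function.Injective lam)
    (ham : a ≤ m) : AlgDegeneratesTo (frameTensor K a m lam) (shadowTensor K a m) := by
  classical
  -- the nodes `λ_ρ ε`: pairwise distinct, all vanishing at `ε = 0`
  obtain ⟨nd, hnd⟩ : ∃ nd : Fin m → K[X], nd = fun ρ => C (lam ρ) * X := ⟨_, rfl⟩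
  have hinj : Function.Injective nd := by
    intro ρ σ hρσ
    apply hlam
    have h1 := congrArg (fun p : K[X] => p.coeff 1) hρσ
    simpa [hnd] using h1
  have h0 : ∀ ρ, (nd ρ).coeff 0 = 0 := fun ρ => by simp [hnd]
  -- step 1 (cleared interpolation) and step 2 (`ε ↦ 0`) of the tree's Ex. 15.9
  have h1 : ∀ z x y : Fin m,
      ∑ ρ, ((∏ σ ∈ Finset.univ.erase ρ, (Lagrange.nodal (Finset.univ.erase σ) nd).eval (nd σ)) *
          (Lagrange.nodal (Finset.univ.erase ρ) nd).coeff z) * nd ρ ^ (x : ℕ) * nd ρ ^ (y : ℕ) =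
        (∏ ρ, (Lagrange.nodal (Finset.univ.erase ρ) nd).eval (nd ρ)) *
          ((X : K[X][X]) ^ ((x : ℕ) + y) %ₘ Lagrange.nodal Finset.univ nd).coeff z :=
    fun z x y => BCS1997Ex159.sum_triads_eq_mul_coeff_modByMonic nd hinj x y z
  have h2 : ∀ z x y : Fin m,
      (((X : K[X][X]) ^ ((x : ℕ) + y) %ₘ Lagrange.nodal Finset.univ nd).coeff z).coeff 0 =
        truncPolyMulTensor K m z x y := by
    intro z x y
    rw [BCS1997Ex159.coeff_zero_coeff_X_pow_modByMonic_nodal nd h0, truncPolyMulTensor_apply]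
  have happrox := isApproxDecomposition_of_sum_eq_mul_of_coeff_zero
    (BCS1997Ex159.prod_eval_nodal_erase_ne_zero nd hinj) h1 h2
  -- step 3: transfer to the frame (second leg `(λ_ρ ε)^x = λ_ρ^x ε^x`)
  refine ⟨_, _, _, _, isApproxRestriction_frame_of_isApproxDecomposition K ham lam happrox ?_⟩
  intro ρ x
  show nd ρ ^ (x : ℕ) = C (lam ρ ^ (x : ℕ)) * X ^ (x : ℕ)
  simp only [hnd]
  rw [mul_pow, C_pow]

variable {K} in
/-- Powers: `P_{a,m}(λ)^{⊠N} ⊵ N_{a,m}^{⊠N}` for every `N`. [cite: BurgisserClausenShokrollahi1997, (15.25)] -/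
theorem frameTensor_kroneckerPow_degeneratesTo {lam : Fin m → K} (hlam : Function.Injective lam)
    (ham : a ≤ m) (N : ℕ) :
    AlgDegeneratesTo (kroneckerPow (frameTensor K a m lam) N) (kroneckerPow (shadowTensor K a m) N) :=
  (frameTensor_degeneratesTo_shadowTensor hlam ham).kroneckerPow N

/-! ## §4 Spectral sandwich: `max(F⟨a⟩, F(N_{a,m})) ≤ F(P_{a,m}(λ)) ≤ m` for every universal spectral point -/

variable {K} in
/-- **Every universal spectral point is sandwiched: `F(N_{a,m}) ≤ F(P_{a,m}(λ)) ≤ m`** (distinct nodes,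
`a ≤ m`; Strassen: spectral points are monotone under degeneration — tree
`IsUniversalSpectralPoint.mono_of_algDegeneratesTo` — and lie below the border rank). [cite: Strassen1988, §3] -/
theorem spectral_sandwich {F : SpectralMap K} (hF : IsUniversalSpectralPoint K F) {lam : Fin m → K}
    (hlam : Function.Injective lam) (ham : a ≤ m) :
    F (shadowTensor K a m) ≤ F (frameTensor K a m lam) ∧ F (frameTensor K a m lam) ≤ (m : ℝ) :=
  ⟨hF.mono_of_algDegeneratesTo (frameTensor_degeneratesTo_shadowTensor hlam ham),
    hF.le_of_algBorderRank_le _ (algBorderRank_frameTensor_le K lam)⟩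

variable {K} in
/-- … and `F⟨a⟩ ≤ F(P_{a,m}(λ))` (distinct nodes, `a ≤ m`; `F⟨a⟩ = a` for a universal point, tree
`IsUniversalSpectralPoint.map_unitTensor`), so `a ≤ F(P_{a,m}(λ)) ≤ m`. [cite: Strassen1988, §3] -/
theorem map_unitTensor_le_frameTensor {F : SpectralMap K} (hF : IsUniversalSpectralPoint K F)
    {lam : Fin m → K} (hlam : Function.Injective lam) (ham : a ≤ m) :
    F (unitTensor K a) ≤ F (frameTensor K a m lam) :=
  hF.mono _ _ (frameTensor_restrictsTo_unitTensor K hlam ham)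

end FieldK

/-! ## §5 Over `ℂ`: the roots-of-unity frames `P_{a,m}(ω)` of g32 -/

section Complex

variable {a m : ℕ}

/-- Over `ℂ` the frame `P_{a,m}(ω)`, `ω = e^{2πi/m}`, degenerates to `N_{a,m}` in order `m − 1`
(`0 < m`, `a ≤ m`). [cite: BurgisserClausenShokrollahi1997, Example (15.20)] -/
theorem frameTensor_degeneratesTo_shadowTensor_complex (hm : 0 < m) (ham : a ≤ m) :
    AlgDegeneratesTo
      (frameTensor ℂ a m fun ρ => Complex.exp (2 * Real.pi * Complex.I / m) ^ (ρ : ℕ))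
      (shadowTensor ℂ a m) :=
  frameTensor_rootsOfUnity_degeneratesTo_shadowTensor (Complex.isPrimitiveRoot_exp m hm.ne') hm ham

/-- Hence over `ℂ`: `F(N_{a,m}) ≤ F(P_{a,m}(ω)) ≤ m` for every universal spectral point `F`
(`0 < m`, `a ≤ m`). [cite: Strassen1988, §3] -/
theorem spectral_sandwich_complex {F : SpectralMap ℂ} (hF : IsUniversalSpectralPoint ℂ F) (hm : 0 < m)
    (ham : a ≤ m) :
    F (shadowTensor ℂ a m) ≤
        F (frameTensor ℂ a m fun ρ => Complex.exp (2 * Real.pi * Complex.I / m) ^ (ρ : ℕ)) ∧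
      F (frameTensor ℂ a m fun ρ => Complex.exp (2 * Real.pi * Complex.I / m) ^ (ρ : ℕ)) ≤ (m : ℝ) :=
  ⟨hF.mono_of_algDegeneratesTo (frameTensor_degeneratesTo_shadowTensor_complex hm ham),
    hF.le_of_algBorderRank_le _ (algBorderRank_frameTensor_le ℂ _)⟩

end Complex

end Summit.MatrixMultiplication.MatrixMultiplication.Theorems.SaturationLadderFrameShadows

end
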